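import Summits.ResolutionOfSingularities.ResolutionOfSingularities.Theorems.RadicialJungCleanModelsWeakEmbeddedLUAlongCoarsening
import Summits.ResolutionOfSingularities.ResolutionOfSingularities.Theorems.FrobeniusClosingSteerCompositeRankLUBelow
import Literature.AlgebraicGeometry.Resolution.RankOneReductionProofs
import Literature.AlgebraicGeometry.Resolution.AffineDomainDimension
import HarnessLib

/-!
# Both valuation-theoretic inputs of Novacoski–Spivakovsky's rank-one reduction of WEAK EMBEDDED local uniformization, in transcendence degree `N + 1`, from weak embedded LU of SINGULAR germs in dimension `≤ N` (every `N`)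

Route `RadicialJung`, crux `CleanModels` (stmt-ResolutionOfSingularities-15917), registered skeleton `Cruxes/CleanModels/Lines/Sketch.lean`
rev 35 (sha16 de44649d8f729c3b), stub 7 `stub_cleanModelsDimGEFour` (asked in EVERY dimension `d ≥ 4`).  Explicit-unit seat `decomp-res-hand-2`
g4 (structural hand); memo `Cruxes/CleanModels/Lines/Sketch-memo-hand2-g4-stubs-5-7.md` §2–§3.  OURS; structural bookkeeping, counted 0; nothing
here proves resolution of singularities in characteristic `p`.

The DIMENSION-GENERIC form («most general landed lemma, then specialise») of hand-2 g4's ✓ `weakEmbeddedLU_along_properCoarsening_dimLEFour`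
(step (i)) and ✓ `weakEmbeddedLU_residueSide_dimLEFour` (step (ii)): for `ν = ν₁ ∘ ν₂` on a function field `K/k` of transcendence degree
`≤ N + 1` (`O ≤ O₁`, `O₁ ≠ O`, `O₁ ≠ K`), BOTH inputs of Novacoski–Spivakovsky 2012 §3.2 — weak embedded LU of `ν₁` realised inside `O`, and weak
embedded LU of `ν₂` on the residue model in the `h₂`-shape of the tree's ✓ `novacoskiSpivakovsky2014_cor217` — follow from ONE hypothesis
`hW N`: weak embedded LU (NS Def. 2.21) for ALL valuations from ARBITRARY finitely generated models of dimension `≤ N`, over every ground field.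
At `N = 3`, `hW 3` is hand-2 g4's ✓ `weakEmbeddedLU_dimLEThree_of_cossartPiltant2019` (F-02 + F-32): PRINT.  So in every dimension
`d = N + 1` the COMPOSITE half of stub 7's local input `hMono_d` reduces to `hW N` (lower-dimensional, singular germs — open for `N ≥ 4`) plus
the purely algebraic combination of NS §3.2 (port over `Literature/…/RankOneReductionProofs.lean`, memo §5 item 3); NO induction on the rank.

* `weakEmbeddedLU_along_properCoarsening_of_lowerDim` — step (i), by rebasing over `k⟮t⟯` (`t ∈ 𝔪_O` an `O₁`-unit) and the Cor. 2.14 device;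
* `weakEmbeddedLU_residueSide_of_lowerDim` — step (ii), on the residue model `φ(A) ≅ A/𝔭` of dimension `≤ N` (`trdeg_k κ < trdeg_k K`).
[cite: NovacoskiSpivakovsky2014, Thm. 1.2, Cor. 2.14, Cor. 2.17, §3.2]
-/

noncomputable section

set_option linter.dupNamespace false -- mandated namespace of this single-conjunct summit

open IsLocalRing AlgebraicGeometry CategoryTheory Polynomial
open Literature.AlgebraicGeometry.Resolution Literature.AlgebraicGeometry.Motives
open Summit.ResolutionOfSingularities.ResolutionOfSingularities.Theorems.SteerRankThinness

namespace Summit.ResolutionOfSingularities.ResolutionOfSingularities.Theorems.RadicialJung.CleanModels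

variable {k K : Type} [Field k] [Field K] [Algebra k K]

/-- **Step (i) in transcendence degree `≤ N + 1` from weak embedded LU of singular germs in dimension `≤ N`**: weak embedded local uniformization
along every PROPER coarsening `O < O₁`, from an arbitrary finitely generated model `A ⊆ O` of dimension `≤ N + 1`, realised INSIDE `O` — by rebasing
over `k⟮t⟯` for an `O₁`-unit `t ∈ 𝔪_O` (residually transcendental, ✓ `Ccurve.valuation_aeval_eq_one`), applying `hW` over `k⟮t⟯`
(`trdeg_{k(t)} K ≤ N` by the tower law), descending, and the Cor. 2.14 device (✓ `exists_model_le_of_model_le_coarsening`).  No regularity,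
zero-dimensionality or rank hypothesis.  At `N = 3` with `hW :=` ✓ `weakEmbeddedLU_dimLEThree_of_cossartPiltant2019` this is
✓ `weakEmbeddedLU_along_properCoarsening_dimLEFour`. [cite: NovacoskiSpivakovsky2014, §3.2 and Cor. 2.14] -/
theorem weakEmbeddedLU_along_properCoarsening_of_lowerDim (N : ℕ)
    (hW : ∀ (k' : Type) [Field k'] (K' : Type) [Field K'] [Algebra k' K']
      (O' : ValuationSubring K') (B : Subalgebra k' K'), B.toSubring ≤ O'.toSubring → B.FG → IsFractionRing B K' →
      ringKrullDim B ≤ (N : ℕ) →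
      ∀ Z : Finset K', (∀ z ∈ Z, z ∈ B) →
      ∃ (B' : Subalgebra k' K'), B'.toSubring ≤ O'.toSubring ∧ B ≤ B' ∧ B'.FG ∧
      ∃ (_ : IsRegularLocalRing (locAtCentre B'.toSubring O')) (e : ℕ) (a : Fin e → ↥(locAtCentre B'.toSubring O')),
        Ideal.span (Set.range a) = IsLocalRing.maximalIdeal ↥(locAtCentre B'.toSubring O') ∧
        ringKrullDim ↥(locAtCentre B'.toSubring O') = (e : WithBot ℕ∞) ∧
        ∀ z ∈ Z, z ≠ 0 → ∃ (v : ↥(locAtCentre B'.toSubring O')) (μ : Fin e → ℕ), IsUnit v ∧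
          z = (v : K') * ∏ i, ((a i : ↥(locAtCentre B'.toSubring O')) : K') ^ (μ i))
    (O O₁ : ValuationSubring K) (hOO₁ : O ≤ O₁) (hne : O₁ ≠ O)
    (A : Subalgebra k K) (hAO : A.toSubring ≤ O.toSubring) (hAfg : A.FG) (hfrac : IsFractionRing A K)
    (hdimA : ringKrullDim A ≤ (N + 1 : ℕ))
    (Z : Finset K) (hZ : ∀ z ∈ Z, z ∈ A) :
    ∃ (A₂ : Subalgebra k K), A₂.toSubring ≤ O.toSubring ∧ A ≤ A₂ ∧ A₂.FG ∧
    ∃ (_ : IsRegularLocalRing (locAtCentre A₂.toSubring O₁)) (e : ℕ) (a : Fin e → ↥(locAtCentre A₂.toSubring O₁)),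
      Ideal.span (Set.range a) = IsLocalRing.maximalIdeal ↥(locAtCentre A₂.toSubring O₁) ∧
      ringKrullDim ↥(locAtCentre A₂.toSubring O₁) = (e : WithBot ℕ∞) ∧
      ∀ z ∈ Z, z ≠ 0 → ∃ (v : ↥(locAtCentre A₂.toSubring O₁)) (μ : Fin e → ℕ), IsUnit v ∧
        z = (v : K) * ∏ i, ((a i : ↥(locAtCentre A₂.toSubring O₁)) : K) ^ (μ i) := by
  classical
  haveI := hfrac
  -- (1) an `O₁`-unit `t` in `𝔪_O`, adjoined to the model: `B = A[t] ⊆ O`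
  obtain ⟨t, htO, hvt, hv₁t⟩ := Ccurve.exists_mem_maximalIdeal_valuation_eq_one O O₁ hOO₁ hne
  let B : Subalgebra k K := Algebra.adjoin k ((A : Set K) ∪ ↑({t} : Finset K))
  have hAB : A ≤ B := fun x hx => Algebra.subset_adjoin (Or.inl hx)
  have htB : t ∈ B := Algebra.subset_adjoin (Or.inr (by simp))
  have hk : ∀ c : k, algebraMap k K c ∈ O := fun c => hAO (A.algebraMap_mem c)
  let Ok : Subalgebra k K := ({ O.toSubring with algebraMap_mem' := hk } : Subalgebra k K)
  have hBO : B.toSubring ≤ O.toSubring := by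
    have h : B ≤ Ok := Algebra.adjoin_le (by
      rintro y (hy | hy)
      · exact hAO hy
      · have : y = t := by simpa using hy
        rw [this]; exact htO)
    exact fun x hx => h hx
  have hBO₁ : B.toSubring ≤ O₁.toSubring := fun x hx => hOO₁ (hBO hx)
  have hBfg : B.FG := fg_adjoin_subalgebra_union A hAfg {t}
  haveI hfrB : IsFractionRing B K := isFractionRing_of_le hAB hfrac
  have hdimB : ringKrullDim B ≤ (N + 1 : ℕ) := by rw [ringKrullDim_eq_of_fg_of_le hAfg hBfg hAB]; exact hdimA
  -- (2) the rebasing field `F = k⟮t⟯ ⊆ locAtCentre B O₁`; `t` is transcendental over `k`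
  let F : IntermediateField k K := IntermediateField.adjoin k ({t} : Set K)
  have hFloc : ∀ z : F, (z : K) ∈ locAtCentre B.toSubring O₁ := fun z =>
    Ccurve.mem_locAtCentre_of_mem_adjoin_simple O O₁ hOO₁ B hBO t htB hvt hv₁t z.2
  have htF : t ∈ F := IntermediateField.mem_adjoin_simple_self k t
  have htransK : Transcendental k t := by
    rintro ⟨q, hq0, hq⟩
    have h1 := Ccurve.valuation_aeval_eq_one O O₁ hOO₁ B hBO t htB hvt hv₁t q hq0
    rw [hq, map_zero] at h1
    exact zero_ne_one h1
  have htransF : Transcendental k (⟨t, htF⟩ : F) := by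
    have hinj : Function.Injective (algebraMap F K) := (algebraMap F K).injective
    exact (transcendental_algebraMap_iff hinj).mp htransK
  -- (3) the `F`-model `Ā = F[s]`, `B = k[s]`, with the same local ring at the centre of `O₁`
  obtain ⟨s, hs⟩ := hBfg
  let Ā : Subalgebra F K := Algebra.adjoin F (s : Set K)
  have hsĀ : ∀ x ∈ (s : Set K), x ∈ Ā := fun x hx => Algebra.subset_adjoin hx
  have hsB : ∀ x ∈ (s : Set K), x ∈ B := fun x hx => by
    rw [← hs]; exact Algebra.subset_adjoin hx
  have hBĀ : B.toSubring ≤ Ā.toSubring := by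
    intro z hz
    have hz' : z ∈ Algebra.adjoin k (s : Set K) := by rw [hs]; exact hz
    have h1 : Algebra.adjoin k (s : Set K) ≤ Ā.restrictScalars k :=
      Algebra.adjoin_le fun x hx => (Subalgebra.mem_restrictScalars k).mpr (hsĀ x hx)
    exact (Subalgebra.mem_restrictScalars k).mp (h1 hz')
  let R₀' : Subalgebra F K := { locAtCentre B.toSubring O₁ with algebraMap_mem' := fun z => hFloc z }
  have hĀR₀ : Ā.toSubring ≤ locAtCentre B.toSubring O₁ := by
    have h1 : Ā ≤ R₀' := Algebra.adjoin_le fun x hx => le_locAtCentre _ _ (hsB x hx)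
    exact fun z hz => h1 hz
  have hĀO₁ : Ā.toSubring ≤ O₁.toSubring := fun z hz => locAtCentre_le hBO₁ (hĀR₀ hz)
  have hĀfg : Ā.FG := ⟨s, rfl⟩
  haveI hfrĀ : IsFractionRing Ā K := by
    refine IsFractionRing.of_field _ K fun z => ?_
    obtain ⟨a, b, hb, hab⟩ := IsFractionRing.div_surjective (A := B) z
    exact ⟨⟨a, hBĀ a.2⟩, ⟨b, hBĀ b.2⟩, hab.symm⟩
  -- (4) `dim Ā ≤ N`: `trdeg_F K ≤ N` by the tower law
  have htrF : Algebra.trdeg F K ≤ N := trdeg_le_of_transcendental_mem F htransF B ⟨s, hs⟩ (N := N) hdimB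
  have hdimĀ : ringKrullDim Ā ≤ (N : ℕ) := ringKrullDim_le_of_fg_of_trdeg_le Ā hĀfg htrF
  -- (5) weak embedded LU in dimension `≤ N` over `F`, along `O₁`
  have hZĀ : ∀ z ∈ Z, z ∈ Ā := fun z hz => hBĀ (hAB (hZ z hz))
  obtain ⟨Ā', hĀ'O₁, hĀĀ', hĀ'fg, hreg', e, a, ha, hdim', hmono⟩ :=
    hW F K O₁ Ā hĀO₁ hĀfg hfrĀ hdimĀ Z hZĀ
  -- (6) descend to the `k`-model `A₁ = k[B ∪ G]`, `Ā' = F[G]`, with the same local ring at the centre of `O₁`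
  obtain ⟨G, hG⟩ := hĀ'fg
  let A₁ : Subalgebra k K := Algebra.adjoin k ((B : Set K) ∪ ↑G)
  have hBA₁ : B ≤ A₁ := fun x hx => Algebra.subset_adjoin (Or.inl hx)
  have hA₁fg : A₁.FG := fg_adjoin_subalgebra_union B ⟨s, hs⟩ G
  have hGĀ' : ∀ g ∈ (G : Set K), g ∈ Ā' := fun g hg => (hG ▸ Algebra.subset_adjoin hg : g ∈ Ā')
  have hA₁Ā' : A₁.toSubring ≤ Ā'.toSubring := by
    have h1 : A₁ ≤ Ā'.restrictScalars k := by
      refine Algebra.adjoin_le ?_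
      rintro y (hy | hy)
      · exact (Subalgebra.mem_restrictScalars k).mpr (hĀĀ' (hBĀ hy))
      · exact (Subalgebra.mem_restrictScalars k).mpr (hGĀ' y hy)
    exact fun x hx => (Subalgebra.mem_restrictScalars k).mp (h1 hx)
  have hA₁O₁ : A₁.toSubring ≤ O₁.toSubring := fun x hx => hĀ'O₁ (hA₁Ā' hx)
  have hFloc₁ : ∀ z : F, (z : K) ∈ locAtCentre A₁.toSubring O₁ := fun z =>
    locAtCentre_mono O₁ (show B.toSubring ≤ A₁.toSubring from fun x hx => hBA₁ hx) (hFloc z)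
  let L₁ : Subalgebra F K := { locAtCentre A₁.toSubring O₁ with algebraMap_mem' := fun z => hFloc₁ z }
  have hĀ'L₁ : Ā'.toSubring ≤ locAtCentre A₁.toSubring O₁ := by
    have h1 : Ā' ≤ L₁ := by
      rw [← hG]
      exact Algebra.adjoin_le fun g hg => le_locAtCentre _ _ (Algebra.subset_adjoin (Or.inr hg))
    exact fun x hx => h1 hx
  have hloc : locAtCentre Ā'.toSubring O₁ = locAtCentre A₁.toSubring O₁ :=
    (locAtCentre_eq_of_mutual_le O₁ A₁.toSubring Ā'.toSubring (hA₁Ā'.trans (le_locAtCentre _ _)) hĀ'L₁).symm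
  -- (7) realise inside `O` with the same local ring at the centre of `O₁`
  obtain ⟨A₂, hA₂O, hAA₂, hA₂fg, heq⟩ :=
    exists_model_le_of_model_le_coarsening O O₁ hOO₁ A hAO hAfg A₁ hA₁O₁ (hAB.trans hBA₁) hA₁fg
  refine ⟨A₂, hA₂O, hAA₂, hA₂fg, ?_⟩
  rw [heq, ← hloc]
  exact ⟨hreg', e, a, ha, hdim', hmono⟩


/-- **Step (ii) (residue side) in transcendence degree `≤ N + 1` from weak embedded LU of singular germs in dimension `≤ N`**, in the `h₂`-shape of
the tree's ✓ `novacoskiSpivakovsky2014_cor217`, with monomial data: `dim A ≤ N + 1` and `O₁ ≠ K` give `trdeg_k κ ≤ N`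
(✓ `SteerRankThinness.trdeg_residueField_lt`), so `dim φ(A) ≤ N` and `hW` applies to the (possibly singular) residue model `φ(A) ≅ A/𝔭`.  At
`N = 3` with `hW :=` ✓ `weakEmbeddedLU_dimLEThree_of_cossartPiltant2019` this is ✓ `weakEmbeddedLU_residueSide_dimLEFour`.
[cite: NovacoskiSpivakovsky2014, Thm. 1.2 and Cor. 2.17] -/
theorem weakEmbeddedLU_residueSide_of_lowerDim (N : ℕ)
    (hW : ∀ (k' : Type) [Field k'] (K' : Type) [Field K'] [Algebra k' K']
      (O' : ValuationSubring K') (B : Subalgebra k' K'), B.toSubring ≤ O'.toSubring → B.FG → IsFractionRing B K' →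
      ringKrullDim B ≤ (N : ℕ) →
      ∀ Z : Finset K', (∀ z ∈ Z, z ∈ B) →
      ∃ (B' : Subalgebra k' K'), B'.toSubring ≤ O'.toSubring ∧ B ≤ B' ∧ B'.FG ∧
      ∃ (_ : IsRegularLocalRing (locAtCentre B'.toSubring O')) (e : ℕ) (a : Fin e → ↥(locAtCentre B'.toSubring O')),
        Ideal.span (Set.range a) = IsLocalRing.maximalIdeal ↥(locAtCentre B'.toSubring O') ∧
        ringKrullDim ↥(locAtCentre B'.toSubring O') = (e : WithBot ℕ∞) ∧
        ∀ z ∈ Z, z ≠ 0 → ∃ (v : ↥(locAtCentre B'.toSubring O')) (μ : Fin e → ℕ), IsUnit v ∧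
          z = (v : K') * ∏ i, ((a i : ↥(locAtCentre B'.toSubring O')) : K') ^ (μ i))
    (O O₁ : ValuationSubring K) (hO : O ≤ O₁) (hO₁ : O₁ ≠ ⊤)
    (A : Subalgebra k K) (hA : A.toSubring ≤ O.toSubring) (hAfg : A.FG) [IsFractionRing A K]
    (hdimA : ringKrullDim A ≤ (N + 1 : ℕ))
    (κ : Type) [Field κ] [Algebra k κ] (ι : κ →+* ResidueField O₁) (φ : A →ₐ[k] κ)
    (hφ : ∀ a : A, ι (φ a) = residue O₁ ⟨(a : K), (hA.trans hO) a.2⟩) (hfr : IsFractionRing φ.range κ)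
    (W : Finset κ) (hWr : ∀ w ∈ W, w ∈ φ.range) :
    ∃ (B : Subalgebra k κ), B.toSubring ≤ ((residueValuationSubring O O₁ hO).comap ι).toSubring ∧ φ.range ≤ B ∧ B.FG ∧
    ∃ (_ : IsRegularLocalRing (locAtCentre B.toSubring ((residueValuationSubring O O₁ hO).comap ι))) (e : ℕ)
      (a : Fin e → ↥(locAtCentre B.toSubring ((residueValuationSubring O O₁ hO).comap ι))),
      Ideal.span (Set.range a) = IsLocalRing.maximalIdeal ↥(locAtCentre B.toSubring ((residueValuationSubring O O₁ hO).comap ι)) ∧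
      ringKrullDim ↥(locAtCentre B.toSubring ((residueValuationSubring O O₁ hO).comap ι)) = (e : WithBot ℕ∞) ∧
      ∀ w ∈ W, w ≠ 0 → ∃ (v : ↥(locAtCentre B.toSubring ((residueValuationSubring O O₁ hO).comap ι))) (μ : Fin e → ℕ), IsUnit v ∧
        w = (v : κ) * ∏ i, ((a i : ↥(locAtCentre B.toSubring ((residueValuationSubring O O₁ hO).comap ι))) : κ) ^ (μ i) := by
  classical
  haveI : Algebra.FiniteType k A := A.fg_iff_finiteType.mp hAfg
  haveI := hfr
  set O₂' := (residueValuationSubring O O₁ hO).comap ι with hO₂'def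
  -- the residue model `φ(A)` lies in the valuation ring of `ν₂` (residues of elements of `O`)
  have hRO₂ : φ.range.toSubring ≤ O₂'.toSubring := by
    rintro x ⟨a, rfl⟩
    change ι (φ a) ∈ residueValuationSubring O O₁ hO
    rw [hφ a]
    exact (residue_mem_residueValuationSubring_iff O O₁ hO _).mpr (hA a.2)
  -- it is finitely generated
  have hRfg : φ.range.FG := by
    rw [← Algebra.map_top]; exact (Algebra.FiniteType.out (R := k) (A := A)).map φ
  -- and of dimension `≤ 3`: `trdeg_k κ < trdeg_k K = dim A ≤ 4`
  obtain ⟨n, hn, htr⟩ := exists_ringKrullDim_eq_and_trdeg_eq k A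
  have hn4 : n ≤ N + 1 := by rw [hn] at hdimA; exact_mod_cast hdimA
  have hK : Algebra.trdeg k K = n := by rw [trdeg_eq_trdeg_of_isFractionRing A, htr]
  have hlt : Algebra.trdeg k κ < (n : Cardinal) := trdeg_residueField_lt O₁ hO₁ A (hA.trans hO) hAfg hK κ ι φ hφ hfr
  obtain ⟨m, hm⟩ := Cardinal.lt_aleph0.mp (hlt.trans (Cardinal.natCast_lt_aleph0 (n := n)))
  have hm3 : Algebra.trdeg k κ ≤ N := by
    rw [hm] at hlt ⊢
    have : m < n := by exact_mod_cast hlt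
    have : m ≤ N := by omega
    exact_mod_cast this
  have hdimR : ringKrullDim φ.range ≤ (N : ℕ) := ringKrullDim_le_of_fg_of_trdeg_le φ.range hRfg hm3
  -- weak embedded LU in dimension `≤ N` from the (possibly singular) model `φ(A)` along `ν₂`
  exact hW k κ O₂' φ.range hRO₂ hRfg hfr hdimR W hWr


end Summit.ResolutionOfSingularities.ResolutionOfSingularities.Theorems.RadicialJung.CleanModels

end
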